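import Summits.HodgeConjecture.CorCM.Census.QuaternionColumnEvenIndep
import Summits.HodgeConjecture.CorCM.Census.QuaternionColumnEven

/-!
# The quaternion column at EVEN level, III: the pivot argument for every even `n ≥ 4` and the law modulo residual generation mod `2`

COR-CM (cell `pub-hodgecm2`), count-neutral kernel combinatorics by the binder seat b09 (gen 40; lane RELATIVE SPLITTING, part VII = gen 39ʼs
QUATERNION COLUMN at even level), on `Census/QuaternionColumn{Indep,Pivot}.lean` (gen 39: `thetaVec`, `faceI`, `idxSet`, the corner-block lemmas),
`Census/QuaternionColumnEvenIndep.lean` (gen 40: `theta_table'`, `fibreIndep_of_thetaVec'`) and `Census/QuaternionColumnEven.lean` (gen 40: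
`isLeast_card_gfaces_generate_of_indep_of_residual`), all BY NAME.  Theorems only: no definition, no certificate, no named fact, no `sorry`.
HONEST FRAMING: `HC_CM` is NOT proved, here or anywhere in the tree; nothing here is a period or a headline.

* §1 `thetaVec_faceI_indep'`: gen 39ʼs pivot argument (`Census/QuaternionColumnPivot.lean` §1) VERBATIM with `n = 2^m` replaced by `Even n` — the
  proof used the `2`-power only through `even_of_pow` and `theta_table`; `qfam_fibreIndep'`: the explicit family `qfam n` is fibre-independent for
  every EVEN `n ≥ 4`.
* §2 **THE LAW AT EVEN LEVEL modulo residual generation mod `2`** (`isLeast_card_gfaces_generate_quaternion_even`): for every EVEN `n ≥ 4`, if the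
  target of `qfam n` mod `2` contains every Hodge vector mod `2` supported on the residual types of `T₀ = barc 0 0` (numerically: `Q₁₆` `48/48`,
  `Q₂₄` `120/120`, `HOME/pub-hodgecm2-b09/lean-g40/RELATIVE-SPLITTING.md`), then `μ(Q_{4n}, c) = φ₂(Q_{4n}, c)`.  Gen 39ʼs `2`-power hypothesis is
  thereby reduced to ONE mod-`2` statement about the explicit family; no `2`-group, Sylow subgroup or factorisation is involved.

## References
* [Pohlmann1968] H. Pohlmann, Algebraic cycles on abelian varieties of complex multiplication type, Ann. of Math. 88 (1968), Thm 1.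
* [Milne1999] J. S. Milne, Lefschetz motives and the Tate conjecture, Compositio Math. 117 (1999), Prop. 2.1, p. 54.
-/

namespace Summit.HodgeConjecture.CorCM.Census.QuaternionColumn

open Finset QuaternionGroup
open Summit.HodgeConjecture.CorCM.Prior.AllgGroup.RfwfAllgGroup
open Summit.HodgeConjecture.CorCM.Census.BlockParity
open Summit.HodgeConjecture.CorCM.Census.Coinvariant
open Summit.HodgeConjecture.CorCM.Census.HalfParity
open Summit.HodgeConjecture.CorCM.Census.Splitting
open Summit.HodgeConjecture.CorCM.Census.BaseBlock
open Summit.HodgeConjecture.CorCM.Census.TwistGeneration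

noncomputable section

variable {n : ℕ} [NeZero n]

/-! ## §1 The pivot argument — gen 39ʼs proof, for every even `n ≥ 4` -/

/-- **THE FUNCTIONAL VECTORS OF THE EXPLICIT FAMILY ARE INDEPENDENT** — every EVEN `n ≥ 4` (gen 39ʼs pivot argument verbatim). [folklore] -/
theorem thetaVec_faceI_indep' (heven : Even n) (h4 : 4 ≤ n) :
    LinearIndepOn (ZMod 2) (fun x => thetaVec (faceI n x)) (idxSet n) := by
  classical
  have hhalf : 2 * (n / 2) = n := by obtain ⟨k, hk⟩ := heven; omega
  set v : ℕ ⊕ ℕ ⊕ ℕ ⊕ ℕ ⊕ ℕ → Block (c n) ⊕ Bool → ZMod 2 := fun x => thetaVec (faceI n x) with hv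
  -- the two biarc parity cycles
  set ye := ∑ t ∈ range (n / 2), fplus (((2 * t + 0 : ℕ) : ℕ) : ZMod (2 * n)) 0 with hye
  set yo := ∑ t ∈ range (n / 2), fplus (((2 * t + 1 : ℕ) : ℕ) : ZMod (2 * n)) 0 with hyo
  have hsum : ∀ r : ℕ, r ≤ 1 → v (Sum.inl (n - 2 + r)) + ∑ t ∈ range (n / 2 - 1), v (Sum.inl (2 * t + r)) =
      thetaVec (∑ t ∈ range (n / 2), fplus (((2 * t + r : ℕ) : ℕ) : ZMod (2 * n)) 0) := by
    intro r hr
    conv_rhs => rw [show n / 2 = (n / 2 - 1) + 1 by omega]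
    rw [sum_range_succ, thetaVec_add, thetaVec_sum, add_comm, show 2 * (n / 2 - 1) + r = n - 2 + r by omega]
    rfl
  have he0 : (Sum.inl (n - 2) : ℕ ⊕ ℕ ⊕ ℕ ⊕ ℕ ⊕ ℕ) ∈ idxSet n := (by change n - 2 < n; omega)
  have he1 : (Sum.inl (n - 1) : ℕ ⊕ ℕ ⊕ ℕ ⊕ ℕ ⊕ ℕ) ∈ idxSet n := (by change n - 1 < n; omega)
  -- first elementary operation: the even cycle
  refine linearIndepOn_of_update_add v (idxSet n) (Sum.inl (n - 2)) he0 (∑ t ∈ range (n / 2 - 1), v (Sum.inl (2 * t + 0))) ?_ ?_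
  · refine Submodule.sum_mem _ fun t ht => Submodule.subset_span ⟨Sum.inl (2 * t + 0), ⟨?_, ?_⟩, rfl⟩
    · change 2 * t + 0 < n; rw [mem_range] at ht; omega
    · rw [mem_range] at ht; simp only [Set.mem_singleton_iff, Sum.inl.injEq]; omega
  set v1 := Function.update v (Sum.inl (n - 2)) (v (Sum.inl (n - 2)) + ∑ t ∈ range (n / 2 - 1), v (Sum.inl (2 * t + 0))) with hv1
  have hv1_of_ne : ∀ x, x ≠ Sum.inl (n - 2) → v1 x = v x := fun x hx => Function.update_of_ne hx _ _
  have hv1_e0 : v1 (Sum.inl (n - 2)) = thetaVec ye := by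
    rw [hv1, Function.update_self, hye, ← hsum 0 (by omega), add_zero]
  -- second elementary operation: the odd cycle
  refine linearIndepOn_of_update_add v1 (idxSet n) (Sum.inl (n - 1)) he1 (∑ t ∈ range (n / 2 - 1), v (Sum.inl (2 * t + 1))) ?_ ?_
  · refine Submodule.sum_mem _ fun t ht => ?_
    rw [mem_range] at ht
    rw [← hv1_of_ne (Sum.inl (2 * t + 1)) (by simp only [ne_eq, Sum.inl.injEq]; omega)]
    refine Submodule.subset_span ⟨Sum.inl (2 * t + 1), ⟨?_, ?_⟩, rfl⟩
    · change 2 * t + 1 < n; omega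
    · simp only [Set.mem_singleton_iff, Sum.inl.injEq]; omega
  set v2 := Function.update v1 (Sum.inl (n - 1)) (v1 (Sum.inl (n - 1)) + ∑ t ∈ range (n / 2 - 1), v (Sum.inl (2 * t + 1))) with hv2
  have hv2_e1 : v2 (Sum.inl (n - 1)) = thetaVec yo := by
    rw [hv2, Function.update_self, hv1_of_ne _ (by simp only [ne_eq, Sum.inl.injEq]; omega), hyo, ← hsum 1 le_rfl,
      show n - 2 + 1 = n - 1 by omega]
  have hv2_e0 : v2 (Sum.inl (n - 2)) = thetaVec ye := by
    rw [hv2, Function.update_of_ne (by simp only [ne_eq, Sum.inl.injEq]; omega), hv1_e0]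
  have hv2_of_ne : ∀ x, x ≠ Sum.inl (n - 2) → x ≠ Sum.inl (n - 1) → v2 x = thetaVec (faceI n x) := fun x h0 h1 => by
    rw [hv2, Function.update_of_ne h1, hv1_of_ne x h0]
  -- the cycle values
  have hye_inl : ∀ B, thetaVec ye (Sum.inl B) = 0 := fun B => by show par (c n) ye B = 0; rw [hye, par_cycle heven 0]; rfl
  have hyo_inl : ∀ B, thetaVec yo (Sum.inl B) = 0 := fun B => by show par (c n) yo B = 0; rw [hyo, par_cycle heven 1]; rfl
  have htab := theta_table' heven
  have hye_f : thetaVec ye (Sum.inr false) = 1 := htab.1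
  have hye_t : thetaVec ye (Sum.inr true) = 1 := htab.2.1
  have hyo_f : thetaVec yo (Sum.inr false) = 1 := htab.2.2.1
  have hyo_t : thetaVec yo (Sum.inr true) = 0 := htab.2.2.2
  -- shorthand facts
  have hmemB : ∀ i : ℕ, i < n → (a (i : ZMod (2 * n)) : QuaternionGroup n) ∈ (barc (0 : ZMod (2 * n)) 0).1 ∧
      (xa (i : ZMod (2 * n)) : QuaternionGroup n) ∈ (barc (0 : ZMod (2 * n)) 0).1 := fun i hi => natCast_mem_base hi
  have hsp := blk_specials (n := n) (by omega)
  -- the pivot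
  refine linearIndepOn_of_pivot (K := ZMod 2) v2 (idxSet n)
    (fun x => match x with
      | Sum.inl k => if k + 1 = n then Sum.inr false else if k + 2 = n then Sum.inr true else Sum.inl (blk (c n) (barc ((k + 2 : ℕ) : ZMod (2 * n)) 0))
      | Sum.inr (Sum.inl i) => Sum.inl (blk (c n) (oflipCM (c n) c_mul_c (a (i : ZMod (2 * n))) (barc 0 0)))
      | Sum.inr (Sum.inr (Sum.inl i)) => Sum.inl (blk (c n) (oflipCM (c n) c_mul_c (a 0) (oflipCM (c n) c_mul_c (a ((i : ZMod (2 * n)) + 1)) (barc 0 0))))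
      | Sum.inr (Sum.inr (Sum.inr (Sum.inl j))) => Sum.inl (blk (c n) (oflipCM (c n) c_mul_c (xa (j : ZMod (2 * n))) (barc 0 0)))
      | Sum.inr (Sum.inr (Sum.inr (Sum.inr j))) =>
          Sum.inl (blk (c n) (oflipCM (c n) c_mul_c (a 0) (oflipCM (c n) c_mul_c (xa ((j : ZMod (2 * n)) + 1)) (barc 0 0)))))
    (fun x => match x with
      | Sum.inl k => if k + 1 = n then 0 else if k + 2 = n then 1 else k + 2
      | Sum.inr (Sum.inl i) => 8 * n - 2 * i
      | Sum.inr (Sum.inr (Sum.inl i)) => 8 * n - 2 * i - 1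
      | Sum.inr (Sum.inr (Sum.inr (Sum.inl j))) => 4 * n - 2 * j
      | Sum.inr (Sum.inr (Sum.inr (Sum.inr j))) => 4 * n - 2 * j - 1) ?_ ?_
  · -- the diagonal
    rintro (k | i | i | j | j) hx
    · change k < n at hx
      by_cases hk1 : k + 1 = n
      · have ek : k = n - 1 := by omega
        subst ek; simp only [hk1, if_true, hv2_e1, hyo_f]; exact one_ne_zero
      by_cases hk2 : k + 2 = n
      · have ek : k = n - 2 := by omega
        subst ek; simp only [hk1, if_false, hk2, if_true, hv2_e0, hye_t]; exact one_ne_zero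
      simp only [hk1, hk2, if_false]
      rw [hv2_of_ne _ (by simp only [ne_eq, Sum.inl.injEq]; omega) (by simp only [ne_eq, Sum.inl.injEq]; omega)]
      show thetaVec (fplus ((k : ℕ) : ZMod (2 * n)) 0) _ ≠ 0
      rw [thetaVec_inl_fplus, if_neg (fun h => ?_), if_pos rfl]
      · exact one_ne_zero
      · have := blk_barc_natCast_inj (by omega) (by omega) h; omega
    · obtain ⟨hi1, hi2⟩ : 1 ≤ i ∧ i + 2 ≤ n := hx
      rw [hv2_of_ne _ (by simp) (by simp)]
      show thetaVec (gface (c n) c_mul_c (barc 0 0) (a (i : ZMod (2 * n))) (xa (-1))) _ ≠ 0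
      refine thetaVec_gface_third ((near_ne i hi1 hi2 0 0).1) ?_ ?_
      · rw [(blk_doubles h4 i).1]; exact ((flip_ne_coinc heven (hmemB i (by omega)).1 i hi1 hi2).1).symm
      · rw [hsp.1]; exact (near_ne i hi1 hi2 _ _).1
    · obtain ⟨hi1, hi2⟩ : 1 ≤ i ∧ i + 2 ≤ n := hx
      rw [hv2_of_ne _ (by simp) (by simp)]
      show thetaVec (gface (c n) c_mul_c (barc 0 0) (a 0) (a ((i : ZMod (2 * n)) + 1))) _ ≠ 0
      refine thetaVec_gface_second ((near_ne i hi1 hi2 0 0).2.1) ?_ ?_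
      · rw [hsp.2.1]; exact (near_ne i hi1 hi2 _ _).2.1
      · by_cases hi3 : i + 3 ≤ n
        · have h := (flip_ne_coinc heven (hmemB (i + 1) (by omega)).1 i hi1 hi2).1; rwa [Nat.cast_succ] at h
        · have ei : i = n - 2 := by omega
          subst ei; rw [hsp.2.2]; exact (near_ne _ hi1 hi2 _ _).2.1
    · obtain ⟨hj1, hj2⟩ : 1 ≤ j ∧ j + 2 ≤ n := hx
      rw [hv2_of_ne _ (by simp) (by simp)]
      show thetaVec (gface (c n) c_mul_c (barc 0 0) (xa (j : ZMod (2 * n))) (xa (-1))) _ ≠ 0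
      refine thetaVec_gface_third ((near_ne j hj1 hj2 0 0).2.2.1) ?_ ?_
      · rw [(blk_doubles h4 j).2.1]
        by_cases hj3 : j + 3 ≤ n
        · exact ((flip_ne_coinc heven (hmemB j (by omega)).2 j hj1 hj2).2 hj3).symm
        · have ej : j = n - 2 := by omega
          subst ej; rw [(blk_doubles h4 0).2.2]; exact (near_ne _ hj1 hj2 _ _).2.2.1
      · rw [hsp.1]; exact (near_ne j hj1 hj2 _ _).2.2.1
    · obtain ⟨hj1, hj3⟩ : 1 ≤ j ∧ j + 3 ≤ n := hx
      rw [hv2_of_ne _ (by simp) (by simp)]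
      show thetaVec (gface (c n) c_mul_c (barc 0 0) (a 0) (xa ((j : ZMod (2 * n)) + 1))) _ ≠ 0
      refine thetaVec_gface_second ((near_ne j hj1 (by omega) 0 0).2.2.2 hj3) ?_ ?_
      · rw [hsp.2.1]; exact (near_ne j hj1 (by omega) _ _).2.2.2 hj3
      · have h := (flip_ne_coinc heven (hmemB (j + 1) (by omega)).2 j hj1 (by omega)).2 hj3; rwa [Nat.cast_succ] at h
  · -- off the pivots
    have hcs : ∀ i : ℕ, ((i : ℕ) : ZMod (2 * n)) + 1 = ((i + 1 : ℕ) : ℕ) := fun i => by push_cast; ring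
    have hmemB' : ∀ i : ℕ, i + 1 < n → (a (((i : ℕ) : ZMod (2 * n)) + 1) : QuaternionGroup n) ∈ (barc (0 : ZMod (2 * n)) 0).1 ∧
        (xa (((i : ℕ) : ZMod (2 * n)) + 1) : QuaternionGroup n) ∈ (barc (0 : ZMod (2 * n)) 0).1 := fun i hi => by
      rw [hcs]; exact hmemB (i + 1) hi
    -- the biarc members (and the two cycles) vanish at every block missed by their outer corners
    have hbi : ∀ k' : ℕ, k' < n → ∀ B : Block (c n),
        (k' + 3 ≤ n → B ≠ blk (c n) (barc ((k' : ℕ) : ZMod (2 * n)) 0) ∧ B ≠ blk (c n) (barc ((k' + 2 : ℕ) : ZMod (2 * n)) 0)) →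
        v2 (Sum.inl k') (Sum.inl B) = 0 := by
      intro k' hk' B hB
      by_cases h1 : k' + 1 = n
      · rw [show k' = n - 1 by omega, hv2_e1]; exact hyo_inl B
      by_cases h2 : k' + 2 = n
      · rw [show k' = n - 2 by omega, hv2_e0]; exact hye_inl B
      rw [hv2_of_ne _ (by simp only [ne_eq, Sum.inl.injEq]; omega) (by simp only [ne_eq, Sum.inl.injEq]; omega)]
      obtain ⟨hB1, hB2⟩ := hB (by omega)
      show thetaVec (fplus ((k' : ℕ) : ZMod (2 * n)) 0) (Sum.inl B) = 0
      rw [thetaVec_inl_fplus, if_neg hB1, if_neg hB2, add_zero]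
    rintro x hx y hy hxy hle
    rcases y with k | i | i | j | j
    · -- pivot of a biarc member / cycle
      change k < n at hy
      by_cases hk1 : k + 1 = n
      · exfalso
        simp only [hk1, if_true, Nat.le_zero] at hle
        rcases x with k' | i' | i' | j' | j' <;> dsimp only at hle
        · change k' < n at hx
          by_cases hk'1 : k' + 1 = n
          · exact hxy (by rw [show k' = k by omega])
          by_cases hk'2 : k' + 2 = n
          · rw [if_neg hk'1, if_pos hk'2] at hle; omega
          · rw [if_neg hk'1, if_neg hk'2] at hle; omega
        all_goals (obtain ⟨hx1, hx2⟩ := hx; omega)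
      by_cases hk2 : k + 2 = n
      · simp only [hk1, if_false, hk2, if_true] at hle ⊢
        rcases x with k' | i' | i' | j' | j' <;> dsimp only at hle
        · change k' < n at hx
          by_cases hk'1 : k' + 1 = n
          · rw [show k' = n - 1 by omega, hv2_e1, hyo_t]
          by_cases hk'2 : k' + 2 = n
          · exact (hxy (by rw [show k' = k by omega])).elim
          · rw [if_neg hk'1, if_neg hk'2] at hle; omega
        all_goals (obtain ⟨hx1, hx2⟩ := hx; omega)
      simp only [hk1, hk2, if_false] at hle ⊢
      rcases x with k' | i' | i' | j' | j' <;> dsimp only at hle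
      · change k' < n at hx
        refine hbi k' hx _ fun hk'3 => ⟨fun h => ?_, fun h => ?_⟩
        · have := blk_barc_natCast_inj (by omega) (by omega) h
          by_cases hk'1 : k' + 1 = n
          · omega
          by_cases hk'2 : k' + 2 = n
          · omega
          rw [if_neg hk'1, if_neg hk'2] at hle; omega
        · have := blk_barc_natCast_inj (by omega) (by omega) h
          have : k' ≠ k := fun e => hxy (by rw [e])
          omega
      all_goals (obtain ⟨hx1, hx2⟩ := hx; omega)
    · -- pivot `blk U_i` of `f_i`
      obtain ⟨hi1, hi2⟩ : 1 ≤ i ∧ i + 2 ≤ n := hy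
      have hU := fun p q => (near_ne i hi1 hi2 p q).1
      dsimp only at hle ⊢
      rcases x with k' | i' | i' | j' | j' <;> dsimp only at hle
      · exact hbi k' hx _ fun _ => ⟨hU _ _ |>.symm, hU _ _ |>.symm⟩
      · obtain ⟨hx1, hx2⟩ : 1 ≤ i' ∧ i' + 2 ≤ n := hx
        have hne : i' ≠ i := fun e => hxy (by rw [e])
        rw [hv2_of_ne _ (by simp) (by simp)]
        refine thetaVec_gface_eq_zero (hU 0 0) ?_ (fun h => hne (blk_U_inj hx1 hx2 hi1 hi2 h)) (by rw [hsp.1]; exact hU _ _)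
        rw [(blk_doubles h4 i').1]; exact ((flip_ne_coinc heven (hmemB i (by omega)).1 i' hx1 hx2).1).symm
      · obtain ⟨hx1, hx2⟩ : 1 ≤ i' ∧ i' + 2 ≤ n := hx
        rw [hv2_of_ne _ (by simp) (by simp)]
        refine thetaVec_gface_eq_zero (hU 0 0) ((flip_ne_coinc heven (hmemB i (by omega)).1 i' hx1 hx2).1.symm)
          (by rw [hsp.2.1]; exact hU _ _) ?_
        by_cases hx3 : i' + 3 ≤ n
        · intro h; rw [hcs i'] at h; have := blk_U_inj (by omega) (by omega) hi1 hi2 h; omega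
        · have ei : i' = n - 2 := by omega
          subst ei; rw [hsp.2.2]; exact hU _ _
      · obtain ⟨hx1, hx2⟩ : 1 ≤ j' ∧ j' + 2 ≤ n := hx
        rw [hv2_of_ne _ (by simp) (by simp)]
        refine thetaVec_gface_eq_zero (hU 0 0) ?_ (blk_U_ne_V h4 hi1 hi2 hx1 hx2).symm (by rw [hsp.1]; exact hU _ _)
        rw [(blk_doubles h4 j').2.1]
        by_cases hx3 : j' + 3 ≤ n
        · exact ((flip_ne_coinc heven (hmemB i (by omega)).1 j' hx1 hx2).2 hx3).symm
        · have ej : j' = n - 2 := by omega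
          subst ej; rw [(blk_doubles h4 0).2.2]; exact hU _ _
      · obtain ⟨hx1, hx3⟩ : 1 ≤ j' ∧ j' + 3 ≤ n := hx
        rw [hv2_of_ne _ (by simp) (by simp)]
        refine thetaVec_gface_eq_zero (hU 0 0) ((flip_ne_coinc heven (hmemB i (by omega)).1 j' hx1 (by omega)).2 hx3).symm
          (by rw [hsp.2.1]; exact hU _ _) ?_
        rw [hcs j']; exact (blk_U_ne_V h4 hi1 hi2 (j := j' + 1) (by omega) (by omega)).symm
    · -- pivot `blk C_i` of `c_i`
      obtain ⟨hi1, hi2⟩ : 1 ≤ i ∧ i + 2 ≤ n := hy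
      have hC := fun p q => (near_ne i hi1 hi2 p q).2.1
      dsimp only at hle ⊢
      rcases x with k' | i' | i' | j' | j' <;> dsimp only at hle
      · exact hbi k' hx _ fun _ => ⟨hC _ _ |>.symm, hC _ _ |>.symm⟩
      · obtain ⟨hx1, hx2⟩ : 1 ≤ i' ∧ i' + 2 ≤ n := hx
        rw [hv2_of_ne _ (by simp) (by simp)]
        refine thetaVec_gface_eq_zero (hC 0 0) ?_ ((flip_ne_coinc heven (hmemB i' (by omega)).1 i hi1 hi2).1) (by rw [hsp.1]; exact hC _ _)
        rw [(blk_doubles h4 i').1]; intro h; have := blk_C_inj hx1 hx2 hi1 hi2 h; omega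
      · obtain ⟨hx1, hx2⟩ : 1 ≤ i' ∧ i' + 2 ≤ n := hx
        have hne : i' ≠ i := fun e => hxy (by rw [e])
        rw [hv2_of_ne _ (by simp) (by simp)]
        refine thetaVec_gface_eq_zero (hC 0 0) (fun h => hne (blk_C_inj hx1 hx2 hi1 hi2 h)) (by rw [hsp.2.1]; exact hC _ _) ?_
        by_cases hx3 : i' + 3 ≤ n
        · exact (flip_ne_coinc heven (hmemB' i' (by omega)).1 i hi1 hi2).1
        · have ei : i' = n - 2 := by omega
          subst ei; rw [hsp.2.2]; exact hC _ _
      · obtain ⟨hx1, hx2⟩ : 1 ≤ j' ∧ j' + 2 ≤ n := hx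
        rw [hv2_of_ne _ (by simp) (by simp)]
        refine thetaVec_gface_eq_zero (hC 0 0) ?_ ((flip_ne_coinc heven (hmemB j' (by omega)).2 i hi1 hi2).1) (by rw [hsp.1]; exact hC _ _)
        rw [(blk_doubles h4 j').2.1]
        by_cases hx3 : j' + 3 ≤ n
        · exact (blk_C_ne_C' h4 hi1 hi2 hx1 hx3).symm
        · have ej : j' = n - 2 := by omega
          subst ej; rw [(blk_doubles h4 0).2.2]; exact hC _ _
      · obtain ⟨hx1, hx3⟩ : 1 ≤ j' ∧ j' + 3 ≤ n := hx
        rw [hv2_of_ne _ (by simp) (by simp)]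
        exact thetaVec_gface_eq_zero (hC 0 0) (blk_C_ne_C' h4 hi1 hi2 hx1 hx3).symm (by rw [hsp.2.1]; exact hC _ _)
          ((flip_ne_coinc heven (hmemB' j' (by omega)).2 i hi1 hi2).1)
    · -- pivot `blk V_j` of `f'_j`
      obtain ⟨hj1, hj2⟩ : 1 ≤ j ∧ j + 2 ≤ n := hy
      have hV := fun p q => (near_ne j hj1 hj2 p q).2.2.1
      dsimp only at hle ⊢
      rcases x with k' | i' | i' | j' | j' <;> dsimp only at hle
      · exact hbi k' hx _ fun _ => ⟨hV _ _ |>.symm, hV _ _ |>.symm⟩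
      · obtain ⟨hx1, hx2⟩ : 1 ≤ i' ∧ i' + 2 ≤ n := hx; exfalso; omega
      · obtain ⟨hx1, hx2⟩ : 1 ≤ i' ∧ i' + 2 ≤ n := hx; exfalso; omega
      · obtain ⟨hx1, hx2⟩ : 1 ≤ j' ∧ j' + 2 ≤ n := hx
        have hne : j' ≠ j := fun e => hxy (by rw [e])
        rw [hv2_of_ne _ (by simp) (by simp)]
        refine thetaVec_gface_eq_zero (hV 0 0) ?_ (fun h => hne (blk_V_inj hx1 hx2 hj1 hj2 h)) (by rw [hsp.1]; exact hV _ _)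
        rw [(blk_doubles h4 j').2.1]
        by_cases hx3 : j' + 3 ≤ n
        · exact ((flip_ne_coinc heven (hmemB j (by omega)).2 j' hx1 hx2).2 hx3).symm
        · have ej : j' = n - 2 := by omega
          subst ej; rw [(blk_doubles h4 0).2.2]; exact hV _ _
      · obtain ⟨hx1, hx3⟩ : 1 ≤ j' ∧ j' + 3 ≤ n := hx
        rw [hv2_of_ne _ (by simp) (by simp)]
        refine thetaVec_gface_eq_zero (hV 0 0) ((flip_ne_coinc heven (hmemB j (by omega)).2 j' hx1 (by omega)).2 hx3).symm
          (by rw [hsp.2.1]; exact hV _ _) ?_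
        intro h; rw [hcs j'] at h; have := blk_V_inj (by omega) (by omega) hj1 hj2 h; omega
    · -- pivot `blk C'_j` of `c'_j`
      obtain ⟨hj1, hj3⟩ : 1 ≤ j ∧ j + 3 ≤ n := hy
      have hC' := fun p q => (near_ne j hj1 (by omega) p q).2.2.2 hj3
      dsimp only at hle ⊢
      rcases x with k' | i' | i' | j' | j' <;> dsimp only at hle
      · exact hbi k' hx _ fun _ => ⟨hC' _ _ |>.symm, hC' _ _ |>.symm⟩
      · obtain ⟨hx1, hx2⟩ : 1 ≤ i' ∧ i' + 2 ≤ n := hx; exfalso; omega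
      · obtain ⟨hx1, hx2⟩ : 1 ≤ i' ∧ i' + 2 ≤ n := hx; exfalso; omega
      · obtain ⟨hx1, hx2⟩ : 1 ≤ j' ∧ j' + 2 ≤ n := hx
        rw [hv2_of_ne _ (by simp) (by simp)]
        refine thetaVec_gface_eq_zero (hC' 0 0) ?_ ((flip_ne_coinc heven (hmemB j' (by omega)).2 j hj1 (by omega)).2 hj3)
          (by rw [hsp.1]; exact hC' _ _)
        rw [(blk_doubles h4 j').2.1]
        by_cases hx3 : j' + 3 ≤ n
        · intro h; have := blk_C'_inj hx1 hx3 hj1 hj3 h; omega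
        · have ej : j' = n - 2 := by omega
          subst ej; rw [(blk_doubles h4 0).2.2]; exact hC' _ _
      · obtain ⟨hx1, hx3⟩ : 1 ≤ j' ∧ j' + 3 ≤ n := hx
        have hne : j' ≠ j := fun e => hxy (by rw [e])
        rw [hv2_of_ne _ (by simp) (by simp)]
        exact thetaVec_gface_eq_zero (hC' 0 0) (fun h => hne (blk_C'_inj hx1 hx3 hj1 hj3 h)) (by rw [hsp.2.1]; exact hC' _ _)
          ((flip_ne_coinc heven (hmemB' j' (by omega)).2 j hj1 (by omega)).2 hj3)


/-- **THE EXPLICIT FAMILY IS FIBRE-INDEPENDENT** for every EVEN `n ≥ 4`. [folklore] -/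
theorem qfam_fibreIndep' (heven : Even n) (h4 : 4 ≤ n) :
    LinearIndepOn (ZMod 2) (fun f : CMF (QuaternionGroup n) (c n) →₀ ℤ => (rad2 (c n) c_mul_c).mkQ (red (c n) f)) ↑(qfam n) := by
  refine fibreIndep_of_thetaVec' heven _ ?_
  rw [coe_qfam_eq_image]
  exact LinearIndepOn.image_of_comp (faceI n) (fun f => thetaVec f) (thetaVec_faceI_indep' heven h4)

/-! ## §2 The law at even level, modulo residual generation mod `2` -/

/-- **THE QUATERNION LAW AT EVEN LEVEL modulo residual generation mod `2`.**  For every EVEN `n ≥ 4`: if the target of `qfam n` mod `2` contains every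
Hodge vector mod `2` supported on the residual types of `T₀ = barc 0 0`, then `μ(Q_{4n}, c) = φ₂(Q_{4n}, c)`. [folklore] -/
theorem isLeast_card_gfaces_generate_quaternion_even (heven : Even n) (h4 : 4 ≤ n)
    (hres : ∀ y ∈ hodge2 (c n) c_mul_c,
      y ∈ Finsupp.supported (ZMod 2) (ZMod 2) {Ψ : CMF (QuaternionGroup n) (c n) | bpot (c n) (barc 0 0) Ψ ≤ 1} →
        y ∈ pair2 (c n) ⊔ Submodule.span (ZMod 2) (translates2 (c n) ((qfam n).image (red (c n))))) :
    IsLeast {k : ℕ | ∃ S : Finset (CMF (QuaternionGroup n) (c n) →₀ ℤ), (↑S ⊆ gfaceSet (QuaternionGroup n) (c n) c_mul_c) ∧ S.card = k ∧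
      hodgeSpan (c n) c_mul_c ≤ Submodule.span ℤ (pairSet (c n)) ⊔ Submodule.span ℤ (translates (c n) S)} (fibreTwo (c n) c_mul_c) :=
  isLeast_card_gfaces_generate_of_indep_of_residual heven h4 (qfam_fibreIndep' heven h4) hres

end

end Summit.HodgeConjecture.CorCM.Census.QuaternionColumn
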